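import Summits.HodgeConjecture.HodgeConjecture.Theorems.PadicSemiregularLiftHodgeFermatVarietiesStubClaimLevelPullTransfer
import Literature.AlgebraicTopology.SingularHomology.FiniteQuotientInvariants
import Literature.AlgebraicGeometry.HodgeTheory.ComplexPointsLocallyContractible
import Literature.NumberTheory.Transcendental.ProjectiveSpaceT2Proofs
import HarnessLib

/-!
# `stub_claimLevelPull` modulo two printed theorems: Fulton Cor. 19.2 (b) and Bredon II.19.2 — line `cancel-by-any-claim-lattice`, crux `HodgeFermatVarieties` (stmt-HodgeConjecture-1334)

Helper file (`--supports stmt-HodgeConjecture-1334`) for the stub `stub_claimLevelPull` (S2↑) of line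
`cancel-by-any-claim-lattice`: claim_m(α') ⟹ claim_{km}(k • α') along the level map
`π : X²ʳ_{km} → X²ʳₘ`, `[xᵢ] ↦ [xᵢᵏ]`. Sequel of `…StubClaimLevelPullTransfer`
(`stub_claimLevelPull_of_transfer`: S2↑ from Fulton Cor. 19.2 (b) and the transfer (M4) for
`fermatLevelMap`). This file discharges (M4) from the printed theorem "the complex cohomology of a
finite quotient is the invariant cohomology", the named fact
`bredon1997_quotient_cohomology_invariants` of `SingularHomology/FiniteQuotientInvariants` (Bredon, *Sheaf Theory*, Thm. II.19.2 with Thm. III.1.1;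
originally Grothendieck, Tôhoku 1957, Ch. V). PROVED here for `π = fermatLevelMap n hk hm` and the
kernel `K = μₖⁿ⁺² = fermatGroup n k` of the `k`-th power map acting on `Xⁿ_{km}(ℂ)` by the diagonal
symmetries (`levelKernelAction`): `Xⁿ_M(ℂ)` is compact Hausdorff and locally contractible
(`compactSpace_complexPoints_fermat`, `t2Space_complexPoints_fermat`,
`locallyContractibleSpace_complexPoints_fermat`); `π(ℂ)` is onto (`map_fermatLevelMap_surjective`);
its fibres are the `K`-orbits (`map_fermatLevelMap_eq_iff`); hence (M4) (`transfer_fermatLevelMap`)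
and **S2↑ modulo the two named facts** (`stub_claimLevelPull_of_facts`, registered).

## References

* [Bredon1997] G. E. Bredon, Sheaf Theory, 2nd ed., GTM 170 (1997), II §19 Thm. 19.1, (47), Thm. 19.2;
  III §1 Thm. 1.1. Held copy read: PDF pp. 157–160, 204–212.
* [Grothendieck1957Tohoku] A. Grothendieck, Tôhoku Math. J. 9 (1957), Ch. V §5.3.
* [ShiodaKatsura1979] T. Shioda, T. Katsura, On Fermat varieties, Tôhoku Math. J. 31 (1979), §1.
* [Aoki1987] N. Aoki, J. Math. Soc. Japan 39 (1987), §1 p. 387 and Cor. 2-3.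
* [Fulton1998] W. Fulton, Intersection Theory, 2nd ed. (1998), §19.2 Cor. 19.2 (b).
-/

set_option linter.dupNamespace false

noncomputable section

open CategoryTheory AlgebraicGeometry Finset Topology
open Literature.AlgebraicGeometry Literature.AlgebraicGeometry.Motives
open Literature.AlgebraicGeometry.HodgeTheory Literature.AlgebraicGeometry.HodgeTheory.FermatCharacter
open Literature.AlgebraicTopology.SingularHomology
open scoped LinearAlgebra.Projectivization

namespace Summit.HodgeConjecture.HodgeConjecture.Theorems.CancelByAnyClaimLattice

/-! ### The kernel `K = μₖⁿ⁺²` of the `k`-th power map and its action on `Xⁿ_{km}(ℂ)` -/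

section KernelAction

variable {n m k : ℕ}

/-- `μₖⁿ⁺² ≤ μ_{km}ⁿ⁺²`: `aᵢᵏ = 1 ⟹ aᵢ^{km} = 1`. [cite: ShiodaKatsura1979, §1] -/
theorem fermatGroup_le_fermatGroup_mul : fermatGroup n k ≤ fermatGroup n (k * m) :=
  fun _ ha ↦ mem_fermatGroup_iff.mpr fun i ↦ by rw [pow_mul, mem_fermatGroup_iff.mp ha i, one_pow]

/-- `a ∈ μₖⁿ⁺² ⟹ aᵏ = 1` (the kernel `K` of `a ↦ aᵏ` on `μ_{km}ⁿ⁺²` is `μₖⁿ⁺²`). [folklore] -/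
theorem pow_eq_one_of_mem_fermatGroup {a : Fin (n + 2) → ℂˣ} (ha : a ∈ fermatGroup n k) :
    a ^ k = 1 :=
  funext fun i ↦ mem_fermatGroup_iff.mp ha i

/-- `aᵏ = 1 ⟹ a ∈ μₖⁿ⁺²`. [folklore] -/
theorem mem_fermatGroup_of_pow_eq_one {a : Fin (n + 2) → ℂˣ} (h : a ^ k = 1) :
    a ∈ fermatGroup n k :=
  mem_fermatGroup_iff.mpr fun i ↦ by rw [← Pi.pow_apply, h, Pi.one_apply]

/-- `g_a = id` when `a = 1` (a dependent form of `diagonalMap_one`, for rewriting under a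
membership proof). [folklore] -/
theorem diagonalMap_eq_id_of_eq_one {F : MvPolynomial (Fin (n + 2)) ℂ} {a : Fin (n + 2) → ℂˣ}
    (ha : a ∈ diagonalStabilizer F) (h : a = 1) : diagonalMap F ha = ContinuousMap.id _ := by
  subst h
  exact diagonalMap_one

variable (n m k) in
/-- **The action of `K = μₖⁿ⁺²` on `Xⁿ_{km}(ℂ)`** by the diagonal symmetries `x ↦ a • x` of the
Fermat form (`diagonalMap`, through `μₖⁿ⁺² ≤ μ_{km}ⁿ⁺² ≤ diagonalStabilizer`); a group action by
`diagonalMap_one`, `diagonalMap_mul`. Used as a local instance only. [cite: ShiodaKatsura1979, §1]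
[cite: Shioda1979PJA, §4] -/
@[reducible]
def levelKernelAction : MulAction (fermatGroup n k) (ComplexPoints (fermatHypersurface n (k * m))) where
  smul a x := diagonalMap (fermatPolynomial ℂ n (k * m))
    (fermatGroup_le_diagonalStabilizer (k * m) (fermatGroup_le_fermatGroup_mul a.2)) x
  one_smul x := by
    change diagonalMap (fermatPolynomial ℂ n (k * m)) _ x = x
    rw [diagonalMap_eq_id_of_eq_one _ rfl, ContinuousMap.id_apply]
  mul_smul a b x := by
    change diagonalMap (fermatPolynomial ℂ n (k * m)) _ x =
      diagonalMap (fermatPolynomial ℂ n (k * m)) _ (diagonalMap (fermatPolynomial ℂ n (k * m)) _ x)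
    rw [← ContinuousMap.comp_apply, ← diagonalMap_mul]

attribute [local instance] levelKernelAction

/-- Unfolding the action: `a • x = g_a x`. [folklore] -/
theorem levelKernel_smul_def (a : fermatGroup n k) (x : ComplexPoints (fermatHypersurface n (k * m))) :
    a • x = diagonalMap (fermatPolynomial ℂ n (k * m))
      (fermatGroup_le_diagonalStabilizer (k * m) (fermatGroup_le_fermatGroup_mul a.2)) x := rfl

/-- The action of `K` is by continuous maps (`diagonalMap` is continuous). [folklore] -/
theorem continuousConstSMul_levelKernel :
    ContinuousConstSMul (fermatGroup n k) (ComplexPoints (fermatHypersurface n (k * m))) :=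
  ⟨fun a ↦ (diagonalMap (fermatPolynomial ℂ n (k * m))
    (fermatGroup_le_diagonalStabilizer (k * m) (fermatGroup_le_fermatGroup_mul a.2))).continuous⟩

end KernelAction

/-! ### `Xⁿ_M(ℂ)` is compact Hausdorff and locally contractible -/

section PointsTopology

variable {n : ℕ}

/-- The Fermat form is homogeneous of its total degree (the hypothesis format of
`Projectivization.isClosed_projZeroLocus`). [folklore] -/
theorem isHomogeneous_totalDegree_fermatPolynomial (M : ℕ) :
    (fermatPolynomial ℂ n M).IsHomogeneous (fermatPolynomial ℂ n M).totalDegree := by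
  by_cases h0 : fermatPolynomial ℂ n M = 0
  · rw [h0]; exact MvPolynomial.isHomogeneous_zero _ _ _
  · rw [(isHomogeneous_fermatPolynomial n M).totalDegree h0]
    exact isHomogeneous_fermatPolynomial n M

/-- The homogeneous-coordinate map `Xⁿ_M(ℂ) → ℙ(ℂⁿ⁺²)` is a closed embedding: an embedding
(`isEmbedding_hypersurfacePoint`) with image the closed zero set `{[z] | Σ zᵢᴹ = 0}`
(`range_hypersurfacePoint`, `Projectivization.isClosed_projZeroLocus`).
[cite: SerreGAGA1956, §2 n°5] -/
theorem isClosedEmbedding_hypersurfacePoint_fermat (M : ℕ) :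
    IsClosedEmbedding (hypersurfacePoint (SmoothHypersurface.hypersurfaceι (fermatPolynomial ℂ n M))) := by
  refine ⟨isEmbedding_hypersurfacePoint _, ?_⟩
  rw [range_hypersurfacePoint (isHomogeneous_fermatPolynomial n M)
    (SmoothHypersurface.range_hypersurfaceι _)]
  exact Projectivization.isClosed_projZeroLocus fun F hF ↦ by
    rw [Set.mem_singleton_iff.mp hF]; exact isHomogeneous_totalDegree_fermatPolynomial M

/-- **`Xⁿ_M(ℂ)` is compact**: closed in the compact `ℙ(ℂⁿ⁺²)`
(`Projectivization.compactSpace_of_properSpace`). [cite: MumfordRedBook1999, I.10 Thm. 2] -/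
theorem compactSpace_complexPoints_fermat (M : ℕ) : CompactSpace (ComplexPoints (fermatHypersurface n M)) := by
  haveI : CompactSpace (ℙ ℂ (Fin (n + 2) → ℂ)) := Projectivization.compactSpace_of_properSpace
  exact (isClosedEmbedding_hypersurfacePoint_fermat M).compactSpace

/-- **`Xⁿ_M(ℂ)` is Hausdorff**: embedded in the Hausdorff `ℙ(ℂⁿ⁺²)`.
[cite: MumfordRedBook1999, I.10 Thm. 1] -/
theorem t2Space_complexPoints_fermat (M : ℕ) : T2Space (ComplexPoints (fermatHypersurface n M)) := by
  haveI : T2Space (ℙ ℂ (Fin (n + 2) → ℂ)) :=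
    Literature.NumberTheory.Transcendental.t2Space_projectivization_holds ℂ (n + 1)
  exact (isEmbedding_hypersurfacePoint (SmoothHypersurface.hypersurfaceι (fermatPolynomial ℂ n M))).t2Space

/-- **`Xⁿ_M(ℂ)` is locally contractible**: complex projective algebraic sets are triangulable
(the tree's `locallyContractibleSpace_complexPoints`, from the proved semialgebraic triangulation
theorem), transported along `{P | pt P ∈ univ} ≃ₜ X(ℂ)`. [cite: OhmotoShiota2017, Thm. 2.2]
[cite: HatcherAT2002, App. Prop. A.4] -/
theorem locallyContractibleSpace_complexPoints_fermat (M : ℕ) :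
    LocallyContractibleSpace (ComplexPoints (fermatHypersurface n M)) :=
  Literature.AlgebraicTopology.Homotopy.locallyContractibleSpace_of_homeomorph
    (⟨Equiv.subtypeUnivEquiv fun P ↦ Set.mem_univ _, continuous_subtype_val, by fun_prop⟩ :
      {P : ComplexPoints (fermatHypersurface n M) // P.pt ∈ (Set.univ : Set _)} ≃ₜ _)
    (locallyContractibleSpace_complexPoints
      ⟨n + 1, SmoothHypersurface.hypersurfaceι (fermatPolynomial ℂ n M), inferInstance⟩ isClosed_univ)

end PointsTopology

/-! ### The level map on complex points: onto, with fibres the `K`-orbits -/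

section Fibres

variable {n m k : ℕ}

attribute [local instance] levelKernelAction

/-- `F(z) = Σ zᵢᴹ` for the Fermat form. [folklore] -/
theorem eval_fermatPolynomial_eq_sum (M : ℕ) (z : Fin (n + 2) → ℂ) :
    MvPolynomial.eval z (fermatPolynomial ℂ n M) = ∑ i, z i ^ M := by
  simp [fermatPolynomial, map_sum]

/-- `[v] ∈ V₊(Σ xᵢᴹ) ↔ Σ vᵢᴹ = 0` for any representative `v` (homogeneity). [folklore] -/
theorem mk_mem_projZeroLocus_fermat_iff (M : ℕ) (v : Fin (n + 2) → ℂ) (hv : v ≠ 0) :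
    Projectivization.mk ℂ v hv ∈ Projectivization.projZeroLocus {fermatPolynomial ℂ n M} ↔
      ∑ i, v i ^ M = 0 := by
  obtain ⟨c, hc⟩ := Projectivization.exists_smul_eq_mk_rep ℂ v hv
  simp only [Projectivization.projZeroLocus, Set.mem_setOf_eq, Set.mem_singleton_iff, forall_eq]
  rw [← hc, Units.smul_def,
    Projectivization.eval_smul_of_isHomogeneous (isHomogeneous_fermatPolynomial n M), mul_eq_zero,
    or_iff_right (pow_ne_zero _ c.ne_zero), eval_fermatPolynomial_eq_sum]

/-- **`π(ℂ) : Xⁿ_{km}(ℂ) → Xⁿₘ(ℂ)` is onto** (`k, m ≥ 1`): given `[w] ∈ Xⁿₘ(ℂ)` choose `zᵢᵏ = wᵢ`;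
then `Σ zᵢ^{km} = Σ wᵢᵐ = 0` and `π[z] = [zᵢᵏ] = [w]`. [cite: ShiodaKatsura1979, §1] -/
theorem map_fermatLevelMap_surjective (hk : 0 < k) (hm : 0 < m) :
    Function.Surjective (AlgPoints.map (L := ℂ) (fermatLevelMap n hk hm)) := by
  intro y
  obtain ⟨w, hw0, hwy⟩ : ∃ (w : Fin (n + 2) → ℂ) (hw : w ≠ 0), Projectivization.mk ℂ w hw =
      hypersurfacePoint (SmoothHypersurface.hypersurfaceι (fermatPolynomial ℂ n m)) y :=
    ⟨_, Projectivization.rep_nonzero _, Projectivization.mk_rep _⟩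
  have hwsum : ∑ i, w i ^ m = 0 := by
    rw [← mk_mem_projZeroLocus_fermat_iff m w hw0, hwy]
    exact hypersurfacePoint_mem_projZeroLocus (isHomogeneous_fermatPolynomial n m)
      (SmoothHypersurface.range_hypersurfaceι _) y
  have hz : ∀ i, ∃ zi : ℂ, zi ^ k = w i := fun i ↦ IsAlgClosed.exists_pow_nat_eq (w i) hk
  choose z hz using hz
  have hz0 : z ≠ 0 := fun h0 ↦ hw0 (funext fun i ↦ by
    rw [← hz i, h0, Pi.zero_apply, zero_pow hk.ne'])
  have hmem : Projectivization.mk ℂ z hz0 ∈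
      Projectivization.projZeroLocus {fermatPolynomial ℂ n (k * m)} := by
    rw [mk_mem_projZeroLocus_fermat_iff]
    simp_rw [pow_mul, hz]
    exact hwsum
  obtain ⟨x, hx⟩ := exists_hypersurfacePoint_eq (isHomogeneous_fermatPolynomial n (k * m))
    (SmoothHypersurface.range_hypersurfaceι _) hmem
  refine ⟨x, (isEmbedding_hypersurfacePoint
    (SmoothHypersurface.hypersurfaceι (fermatPolynomial ℂ n m))).injective ?_⟩
  rw [hypersurfacePoint_map_fermatLevelMap hk hm x, ← hwy, Projectivization.mk_eq_mk_iff']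
  obtain ⟨u, hu⟩ := Projectivization.exists_smul_eq_mk_rep ℂ z hz0
  refine ⟨(u : ℂ) ^ k, funext fun i ↦ ?_⟩
  rw [hx, ← hu]
  simp only [Pi.smul_apply, smul_eq_mul, Units.smul_def, mul_pow, hz]

/-- **`π(a • x) = π(x)` for `a ∈ K`**: `π ∘ g_a = g_{aᵏ} ∘ π`
(`mapContinuous_comp_diagonalMap_of_levelMap`, from the points formula) and `aᵏ = 1`.
[cite: ShiodaKatsura1979, §1] -/
theorem map_fermatLevelMap_smul (hk : 0 < k) (hm : 0 < m) (a : fermatGroup n k)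
    (x : ComplexPoints (fermatHypersurface n (k * m))) :
    AlgPoints.map (fermatLevelMap n hk hm) (a • x) = AlgPoints.map (fermatLevelMap n hk hm) x := by
  have h := DFunLike.congr_fun (mapContinuous_comp_diagonalMap_of_levelMap
    (fermatLevelMap n hk hm) (exists_rep_hypersurfacePoint_map_fermatLevelMap hk hm)
    (fermatGroup_le_fermatGroup_mul (m := m) a.2)) x
  have h1 : diagonalMap (fermatPolynomial ℂ n m) (fermatGroup_le_diagonalStabilizer m
      (pow_mem_fermatGroup_of_mem_mul (fermatGroup_le_fermatGroup_mul (m := m) a.2))) =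
      ContinuousMap.id _ :=
    diagonalMap_eq_id_of_eq_one _ (pow_eq_one_of_mem_fermatGroup a.2)
  rw [h1] at h
  rw [levelKernel_smul_def]
  simpa only [ContinuousMap.comp_apply, ContinuousMap.id_apply, AlgPoints.mapContinuous_apply] using h

/-- **Points of `Xⁿ_{km}(ℂ)` with the same image under `π` differ by an element of `K`.** If
`t z'ᵢᵏ = zᵢᵏ` (`t ≠ 0`), pick `sᵏ = t`; then `aᵢ = s z'ᵢ / zᵢ` (`aᵢ = 1` where `zᵢ = 0 = z'ᵢ`) is a
`k`-th root of unity with `a • z = s • z'`, so `g_a x = x'`. [cite: ShiodaKatsura1979, §1] -/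
theorem exists_smul_eq_of_map_fermatLevelMap_eq (hk : 0 < k) (hm : 0 < m)
    {x x' : ComplexPoints (fermatHypersurface n (k * m))}
    (h : AlgPoints.map (fermatLevelMap n hk hm) x = AlgPoints.map (fermatLevelMap n hk hm) x') :
    ∃ a : fermatGroup n k, a • x = x' := by
  set z := (hypersurfacePoint (SmoothHypersurface.hypersurfaceι (fermatPolynomial ℂ n (k * m))) x).rep
    with hzdef
  set z' := (hypersurfacePoint (SmoothHypersurface.hypersurfaceι (fermatPolynomial ℂ n (k * m))) x').rep
    with hz'def
  have hcoord := congrArg (hypersurfacePoint (SmoothHypersurface.hypersurfaceι (fermatPolynomial ℂ n m))) h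
  rw [hypersurfacePoint_map_fermatLevelMap hk hm x, hypersurfacePoint_map_fermatLevelMap hk hm x',
    Projectivization.mk_eq_mk_iff'] at hcoord
  obtain ⟨t, ht⟩ := hcoord
  have ht' : ∀ i, t * z' i ^ k = z i ^ k := fun i ↦ by
    simpa only [Pi.smul_apply, smul_eq_mul] using congrFun ht i
  have ht0 : t ≠ 0 := by
    rintro rfl
    refine Projectivization.rep_nonzero
      (hypersurfacePoint (SmoothHypersurface.hypersurfaceι (fermatPolynomial ℂ n (k * m))) x) ?_
    funext i
    exact (pow_eq_zero_iff hk.ne').mp ((ht' i).symm.trans (zero_mul _))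
  obtain ⟨s, hs⟩ := IsAlgClosed.exists_pow_nat_eq t hk
  have hs0 : s ≠ 0 := by rintro rfl; exact ht0 (by rw [← hs, zero_pow hk.ne'])
  have hzz' : ∀ i, z i = 0 → z' i = 0 := fun i hi ↦ by
    have := ht' i
    rw [hi, zero_pow hk.ne', mul_eq_zero, or_iff_right ht0] at this
    exact (pow_eq_zero_iff hk.ne').mp this
  have hz'ne : ∀ i, z i ≠ 0 → z' i ≠ 0 := fun i hi hi' ↦ hi ((pow_eq_zero_iff hk.ne').mp
    ((ht' i).symm.trans (by rw [hi', zero_pow hk.ne', mul_zero])))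
  classical
  let a : Fin (n + 2) → ℂˣ := fun i ↦
    if hi : z i = 0 then 1 else Units.mk0 (z' i * s / z i) (by
      exact div_ne_zero (mul_ne_zero (hz'ne i hi) hs0) hi)
  have ha_apply : ∀ i, (a i : ℂ) * z i = s * z' i := fun i ↦ by
    by_cases hi : z i = 0
    · simp only [a, hi, dif_pos, Units.val_one, mul_zero, hzz' i hi]
    · simp only [a, hi, dif_neg, not_false_eq_true, Units.val_mk0]
      field_simp
  have hak : a ^ k = 1 := by
    funext i
    rw [Pi.pow_apply, Pi.one_apply]
    by_cases hi : z i = 0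
    · simp only [a, hi, dif_pos, one_pow]
    · ext
      rw [Units.val_pow_eq_pow_val, Units.val_one]
      have h1 : ((a i : ℂ) * z i) ^ k = (s * z' i) ^ k := by rw [ha_apply i]
      rw [mul_pow, mul_pow, hs, ht' i] at h1
      exact mul_right_cancel₀ (pow_ne_zero _ hi) (h1.trans (one_mul _).symm)
  refine ⟨⟨a, mem_fermatGroup_of_pow_eq_one hak⟩, ?_⟩
  apply (isEmbedding_hypersurfacePoint
    (SmoothHypersurface.hypersurfaceι (fermatPolynomial ℂ n (k * m)))).injective
  rw [levelKernel_smul_def, hypersurfacePoint_diagonalMap,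
    ← Projectivization.mk_rep (hypersurfacePoint _ x'), Projectivization.mk_eq_mk_iff']
  refine ⟨s, ?_⟩
  funext i
  rw [Pi.smul_apply, smul_eq_mul, smul_apply_eq_mul]
  exact (ha_apply i).symm

/-- **The fibres of `π(ℂ)` are exactly the `K`-orbits**: `π x = π x' ↔ x' = a • x` for some
`a ∈ μₖⁿ⁺²` — topologically, `π(ℂ)` is the orbit map `Xⁿ_{km}(ℂ) → Xⁿ_{km}(ℂ)/μₖⁿ⁺² ≅ Xⁿₘ(ℂ)`.
[cite: ShiodaKatsura1979, §1] -/
theorem map_fermatLevelMap_eq_iff (hk : 0 < k) (hm : 0 < m)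
    (x x' : ComplexPoints (fermatHypersurface n (k * m))) :
    AlgPoints.map (fermatLevelMap n hk hm) x = AlgPoints.map (fermatLevelMap n hk hm) x' ↔
      ∃ a : fermatGroup n k, a • x = x' :=
  ⟨exists_smul_eq_of_map_fermatLevelMap_eq hk hm, by
    rintro ⟨a, rfl⟩; exact (map_fermatLevelMap_smul hk hm a x).symm⟩

end Fibres

/-! ### (M4) for the level map from the named fact, and S2↑ -/

section Transfer

variable {n m k : ℕ}

attribute [local instance] levelKernelAction

/-- **(M4) — the transfer for the level map, from the named fact.** Granted
`bredon1997_quotient_cohomology_invariants`, for `k, m ≥ 1` every class `c ∈ Hⁱ(Xⁿ_{km}(ℂ); ℂ)`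
fixed by `g_a^*` for all `a ∈ μ_{km}ⁿ⁺²` with `aᵏ = 1` lies in the range of `π^*`: the fact applied
to `K = μₖⁿ⁺²` acting on the compact Hausdorff locally contractible `Xⁿ_{km}(ℂ)` and `q = π(ℂ)`, onto
with fibres the `K`-orbits. This is hypothesis (M4) of `stub_claimLevelPull_of_transfer`, verbatim,
for every `n`. [cite: Bredon1997, II Thm. 19.2] [cite: ShiodaKatsura1979, §1] -/
theorem transfer_fermatLevelMap (hB : bredon1997_quotient_cohomology_invariants)
    (hm : 0 < m) (hk : 0 < k) (i : ℕ) (c : complexBetti (fermatHypersurface n (k * m)) i)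
    (hc : ∀ (a : Fin (n + 2) → ℂˣ) (ha : a ∈ fermatGroup n (k * m)), a ^ k = 1 →
      singularCohomology.map ℂ ℂ (diagonalMap (fermatPolynomial ℂ n (k * m))
        (fermatGroup_le_diagonalStabilizer (k * m) ha)) i c = c) :
    c ∈ LinearMap.range (complexBetti.map (fermatLevelMap n hk hm) i).hom := by
  haveI := compactSpace_complexPoints_fermat (n := n) (k * m)
  haveI := t2Space_complexPoints_fermat (n := n) (k * m)
  haveI := t2Space_complexPoints_fermat (n := n) m
  haveI : NeZero k := ⟨hk.ne'⟩
  haveI := continuousConstSMul_levelKernel (n := n) (m := m) (k := k)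
  obtain ⟨-, h⟩ := hB (G := fermatGroup n k) (locallyContractibleSpace_complexPoints_fermat (k * m))
    (locallyContractibleSpace_complexPoints_fermat m)
    (AlgPoints.mapContinuous (L := ℂ) (fermatLevelMap n hk hm))
    (fun y ↦ map_fermatLevelMap_surjective hk hm y)
    (fun x x' ↦ map_fermatLevelMap_eq_iff hk hm x x') i
  obtain ⟨c₀, hc₀⟩ := h c fun a ↦ by
    have ha : (⟨fun z ↦ a • z, continuous_const_smul a⟩ : C(_, _)) =
        diagonalMap (fermatPolynomial ℂ n (k * m))
          (fermatGroup_le_diagonalStabilizer (k * m) (fermatGroup_le_fermatGroup_mul a.2)) :=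
      ContinuousMap.ext fun _ ↦ rfl
    rw [ha]
    exact hc _ (fermatGroup_le_fermatGroup_mul a.2) (pow_eq_one_of_mem_fermatGroup a.2)
  exact ⟨c₀, hc₀⟩

/-- **S2↑ `stub_claimLevelPull` modulo the two printed theorems (registered conditional form).**
GRANTED the named facts `fulton1998_map_mem_algebraicClasses` (Fulton, Cor. 19.2 (b): pull-back along
a morphism of smooth projective complex varieties preserves `Nᵖ H²ᵖ`) and
`bredon1997_quotient_cohomology_invariants` (Bredon II.19.2 with III.1.1), claim pulls back along the
level map `[xᵢ] ↦ [xᵢᵏ]`: claim_m(α') ⟹ claim_{km}(k • α') for every `k ≥ 1`, `r`, zero-free `α'` —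
the registered statement of `stub_claimLevelPull` (`stub_claimLevelPull_of_transfer` with
(M4) = `transfer_fermatLevelMap` at `n = 2r`). [cite: ShiodaKatsura1979, §1]
[cite: Aoki1987, §1 p. 387 and Cor. 2-3] [cite: Fulton1998, §19.2 Cor. 19.2 (b)]
[cite: Bredon1997, II Thm. 19.2 and III Thm. 1.1] -/
theorem stub_claimLevelPull_of_facts : fulton1998_map_mem_algebraicClasses → bredon1997_quotient_cohomology_invariants → ∀ (m k r : ℕ) (α' : Fin (2 * r + 2) → ZMod m), 0 < k → (∀ i, α' i ≠ 0) → FermatCharacter.Claim m r α' → FermatCharacter.Claim (k * m) r (fun i => ((k * (α' i).val : ℕ) : ZMod (k * m))) :=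
  fun hF hB ↦ stub_claimLevelPull_of_transfer hF
    fun _ _ r hm hk c hc ↦ transfer_fermatLevelMap hB hm hk (2 * r) c hc

end Transfer

end Summit.HodgeConjecture.HodgeConjecture.Theorems.CancelByAnyClaimLattice

end
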